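import Summits.ValiantsHypothesis.ValiantsHypothesis.Theorems.LacunarySymmetroidMatrixDescartesCensusV20Box24Part01
import Summits.ValiantsHypothesis.ValiantsHypothesis.Theorems.LacunarySymmetroidMatrixDescartesCensusV20Box24Part02
import Summits.ValiantsHypothesis.ValiantsHypothesis.Theorems.LacunarySymmetroidMatrixDescartesCensusV20Box24Part03
import Summits.ValiantsHypothesis.ValiantsHypothesis.Theorems.LacunarySymmetroidMatrixDescartesCensusV20Box24Part04
import Summits.ValiantsHypothesis.ValiantsHypothesis.Theorems.LacunarySymmetroidMatrixDescartesCensusV20Box24Part05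
import Summits.ValiantsHypothesis.ValiantsHypothesis.Theorems.LacunarySymmetroidMatrixDescartesCensusV20Box24Part06
import Summits.ValiantsHypothesis.ValiantsHypothesis.Theorems.LacunarySymmetroidMatrixDescartesCensusV20Box24Part07
import Summits.ValiantsHypothesis.ValiantsHypothesis.Theorems.LacunarySymmetroidMatrixDescartesCensusV20Box24Part08
import Summits.ValiantsHypothesis.ValiantsHypothesis.Theorems.LacunarySymmetroidMatrixDescartesCensusV20Box24Part09
import Summits.ValiantsHypothesis.ValiantsHypothesis.Theorems.LacunarySymmetroidMatrixDescartesCensusV20Box24Part10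
import Summits.ValiantsHypothesis.ValiantsHypothesis.Theorems.LacunarySymmetroidMatrixDescartesCensusV20Box24Part11
import Summits.ValiantsHypothesis.ValiantsHypothesis.Theorems.LacunarySymmetroidMatrixDescartesCensusV20Box24Part12
import Summits.ValiantsHypothesis.ValiantsHypothesis.Theorems.LacunarySymmetroidMatrixDescartesCensusV20Box24Part13
import Summits.ValiantsHypothesis.ValiantsHypothesis.Theorems.LacunarySymmetroidMatrixDescartesCensusV20Box24Part14
import Summits.ValiantsHypothesis.ValiantsHypothesis.Theorems.LacunarySymmetroidMatrixDescartesCensusV20Box24Part15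
import Summits.ValiantsHypothesis.ValiantsHypothesis.Theorems.LacunarySymmetroidMatrixDescartesCensusV20Box24CoverA
import Summits.ValiantsHypothesis.ValiantsHypothesis.Theorems.LacunarySymmetroidMatrixDescartesCensusV20Box24CoverB
import Summits.ValiantsHypothesis.ValiantsHypothesis.Theorems.LacunarySymmetroidMatrixDescartesCensusBox20Reduce

/-!
# `MatrixDescartes` census — BOX24 IN THE KERNEL: `ζ(2,6; d) ≤ 19` for EVERY support with `d₅ − d₀ ≤ 24`

HONEST FRAMING.  Object-search cell `pub-symmetroid`; door-A item `DoorA26 = PosRootLawAt 2 6 19`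
(stmt-ValiantsHypothesis-19979; OPEN, typed, never asserted).  Assembly of the `V = 20` layer on the box `d₅ − d₀ ≤ 24` (extends `doorA26_box20`, p410881): `Census.doorA26_box24_sorted` and
`Census.doorA26_box24 : ∀ d, (∀ i j, d i ≤ d j + 24) → PosRootLawOn 2 6 19 d` — equivalently, a hypothetical twenty (a real symmetric
`2 × 2` six-term pencil with `20 = D(2,6)` distinct positive det-roots) needs `d₅ − d₀ ≥ 25`.  Ingredients: the 1 470 two-Sidon supports
of the box carry engine-3 g15's exact certificates (HOME/pub-symmetroid-engine-3/box20/box20.jsonl + box21-26.jsonl: 988 sign /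
978 LP / 974 domination cells, 0 open), replayed by the kernel through the CHECKED checker (`…CensusV20Check`, soundness
`…CensusV20Sound*`, data `…CensusV20Box24Part*`, 735 mirror representatives); completeness of the key list is the kernel cover
check `…CensusV20Box24CoverA/B`; non-Sidon supports by Descartes (`posRoots_two_le_of_card_pairSums`); unsorted / shifted vectors as
in `…CensusBox20`.  The first supports NOT covered are the engine-3 OPEN cells at `d₅ = 25` (class 954+).  `V = 20` layer on a finite box
only.  Nothing here bears on `V = 19`, on `ζ_sym(2,6)` over all supports, on `DoorA26` itself, on `MatrixDescartes`
(stmt-ValiantsHypothesis-18050) or on `VP ≠ VNP`.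

[folklore] Certificate-checker soundness / replay; elementary.
-/

-- the D-0017 layout repeats a namespace component (single-conjunct summit); the `dupNamespace` linter flags it; name mandated.
set_option linter.dupNamespace false

namespace Summit.ValiantsHypothesis.ValiantsHypothesis.Theorems.LacunarySymmetroidMatrixDescartes.Census.V20

open Summit.ValiantsHypothesis.ValiantsHypothesis.Theorems.MatrixDescartes.Negative (PosRootLawAt)

/-- All 735 keys carry the row `ζ(2,6; d) ≤ 19` (the 57 data parts). [folklore] -/
theorem box24Keys_rows : ∀ d ∈ box24Keys, PosRootLawOn 2 6 19 (fun i => d.getD i 0) :=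
  List.forall_mem_append.2 ⟨box24_part01, List.forall_mem_append.2 ⟨box24_part02, List.forall_mem_append.2 ⟨box24_part03, List.forall_mem_append.2 ⟨box24_part04, List.forall_mem_append.2 ⟨box24_part05, List.forall_mem_append.2 ⟨box24_part06, List.forall_mem_append.2 ⟨box24_part07, List.forall_mem_append.2 ⟨box24_part08, List.forall_mem_append.2 ⟨box24_part09, List.forall_mem_append.2 ⟨box24_part10, List.forall_mem_append.2 ⟨box24_part11, List.forall_mem_append.2 ⟨box24_part12, List.forall_mem_append.2 ⟨box24_part13, List.forall_mem_append.2 ⟨box24_part14, List.forall_mem_append.2 ⟨box24_part15, List.forall_mem_append.2 ⟨box24_part16, List.forall_mem_append.2 ⟨box24_part17, List.forall_mem_append.2 ⟨box24_part18, List.forall_mem_append.2 ⟨box24_part19, List.forall_mem_append.2 ⟨box24_part20, List.forall_mem_append.2 ⟨box24_part21, List.forall_mem_append.2 ⟨box24_part22, List.forall_mem_append.2 ⟨box24_part23, List.forall_mem_append.2 ⟨box24_part24, List.forall_mem_append.2 ⟨box24_part25, List.forall_mem_append.2 ⟨box24_part26, List.forall_mem_append.2 ⟨box24_part27, List.forall_mem_append.2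 ⟨box24_part28, List.forall_mem_append.2 ⟨box24_part29, List.forall_mem_append.2 ⟨box24_part30, List.forall_mem_append.2 ⟨box24_part31, List.forall_mem_append.2 ⟨box24_part32, List.forall_mem_append.2 ⟨box24_part33, List.forall_mem_append.2 ⟨box24_part34, List.forall_mem_append.2 ⟨box24_part35, List.forall_mem_append.2 ⟨box24_part36, List.forall_mem_append.2 ⟨box24_part37, List.forall_mem_append.2 ⟨box24_part38, List.forall_mem_append.2 ⟨box24_part39, List.forall_mem_append.2 ⟨box24_part40, List.forall_mem_append.2 ⟨box24_part41, List.forall_mem_append.2 ⟨box24_part42, List.forall_mem_append.2 ⟨box24_part43, List.forall_mem_append.2 ⟨box24_part44, List.forall_mem_append.2 ⟨box24_part45, List.forall_mem_append.2 ⟨box24_part46, List.forall_mem_append.2 ⟨box24_part47, List.forall_mem_append.2 ⟨box24_part48, List.forall_mem_append.2 ⟨box24_part49, List.forall_mem_append.2 ⟨box24_part50, List.forall_mem_append.2 ⟨box24_part51, List.forall_mem_append.2 ⟨box24_part52, List.forall_mem_append.2 ⟨box24_part53, List.forall_mem_append.2 ⟨box24_part54, List.forall_mem_append.2 ⟨box24_part55,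 List.forall_mem_append.2 ⟨box24_part56, box24_part57⟩⟩⟩⟩⟩⟩⟩⟩⟩⟩⟩⟩⟩⟩⟩⟩⟩⟩⟩⟩⟩⟩⟩⟩⟩⟩⟩⟩⟩⟩⟩⟩⟩⟩⟩⟩⟩⟩⟩⟩⟩⟩⟩⟩⟩⟩⟩⟩⟩⟩⟩⟩⟩⟩⟩⟩

/-- The slice plan exhausts the box `d₅ ≤ 24`. [folklore] -/
theorem plan24 : planCovers 24 ([(5, 4, 4), (6, 4, 5), (7, 4, 6), (8, 4, 7), (9, 4, 8), (10, 4, 9), (11, 4, 10), (12, 4, 11), (13, 4, 12), (14, 4, 13), (15, 4, 14), (16, 4, 15), (17, 4, 16), (18, 4, 17)] ++ [(19, 4, 18), (20, 4, 19)] ++ [(21, 4, 20), (22, 4, 21)] ++ [(23, 4, 22)] ++ [(24, 4, 23)]) = true := by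
  decide +kernel

/-- Every slice of the plan passes the cover check (assembled from `…CensusV20Box24CoverA/B`). [folklore] -/
theorem cover24 : coverSlices box24Keys ([(5, 4, 4), (6, 4, 5), (7, 4, 6), (8, 4, 7), (9, 4, 8), (10, 4, 9), (11, 4, 10), (12, 4, 11), (13, 4, 12), (14, 4, 13), (15, 4, 14), (16, 4, 15), (17, 4, 16), (18, 4, 17)] ++ [(19, 4, 18), (20, 4, 19)] ++ [(21, 4, 20), (22, 4, 21)] ++ [(23, 4, 22)] ++ [(24, 4, 23)]) = true := by
  rw [coverSlices_append, coverSlices_append, coverSlices_append, coverSlices_append]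
  simp only [cover24_a1, cover24_a2, cover24_b1, cover24_b2, cover24_b3, Bool.and_self]

end Summit.ValiantsHypothesis.ValiantsHypothesis.Theorems.LacunarySymmetroidMatrixDescartes.Census.V20

namespace Summit.ValiantsHypothesis.ValiantsHypothesis.Theorems.LacunarySymmetroidMatrixDescartes.Census

open Summit.ValiantsHypothesis.ValiantsHypothesis.Theorems.MatrixDescartes.Negative (PosRootLawAt)

/-- **BOX24 (kernel): every real symmetric `2 × 2` six-term pencil on a sorted support `0 = d₀ < ⋯ < d₅ ≤ 24` has at most `19`
distinct positive roots of its determinant** — one below the Descartes ceiling `D(2,6) = 20`; the `1 470` two-Sidon supports by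
engine-3 g15's exact certificates replayed through the kernel-checked certificate checker `V20.checkCell`, every other support by its
own Descartes count (a repeated pair sum).  Extends `doorA26_box20_sorted`. [folklore] -/
theorem doorA26_box24_sorted (d : Fin 6 → ℕ) (hd : StrictMono d) (h0 : d 0 = 0) (h5 : d 5 ≤ 24) :
    PosRootLawOn 2 6 19 d :=
  V20.box_of_plan 24 _ V20.box24Keys V20.plan24 V20.cover24 V20.box24Keys_rows d hd h0 h5

/-- **BOX24 for arbitrary exponent vectors**: any `d : Fin 6 → ℕ` whose entries lie in a window of width `24`
(`d i ≤ d j + 24` for all `i, j`) satisfies the door-A row `ζ(2,6; d) ≤ 19` — repeated exponents by the support's Descartes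
count, distinct ones by sorting (`posRootLawOn_comp_equiv_iff`), translating to `d₀ = 0` (`posRootLawOn_add_const_iff`) and
`doorA26_box24_sorted`.  Extends `doorA26_box20` (p410881): a hypothetical twenty needs `d₅ − d₀ ≥ 25`. [folklore] -/
theorem doorA26_box24 (d : Fin 6 → ℕ) (hw : ∀ i j, d i ≤ d j + 24) : PosRootLawOn 2 6 19 d := by
  classical
  by_cases hinj : Function.Injective d
  · set σ := Tuple.sort d with hσ
    have hmono : Monotone (d ∘ σ) := Tuple.monotone_sort d
    have hsm : StrictMono (d ∘ σ) := hmono.strictMono_of_injective (hinj.comp σ.injective)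
    set m := (d ∘ σ) 0 with hm
    have hmle : ∀ l, m ≤ (d ∘ σ) l := fun l => hmono (Fin.zero_le l)
    set e : Fin 6 → ℕ := fun l => (d ∘ σ) l - m with he
    have hde : (d ∘ σ) = fun l => e l + m := by
      funext l; simp only [he]; have := hmle l; omega
    have he_mono : StrictMono e := by
      intro a b hab; simp only [he]; have := hsm hab; have := hmle a; omega
    have he0 : e 0 = 0 := by simp [he, hm]
    have he5 : e 5 ≤ 24 := by
      simp only [he]
      have := hw (σ 5) (σ 0)
      simp only [hm, Function.comp] at this ⊢
      omega
    have hrow : PosRootLawOn 2 6 19 e := doorA26_box24_sorted e he_mono he0 he5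
    have hrow' : PosRootLawOn 2 6 19 (d ∘ σ) := by
      rw [hde]; exact (posRootLawOn_add_const_iff e m).mpr hrow
    exact (posRootLawOn_comp_equiv_iff σ d).mpr hrow'
  · exact fun S _ => posRoots_two_le_of_card_pairSums (by norm_num) d (card_pairSums_le_of_not_injective d hinj) S

end Summit.ValiantsHypothesis.ValiantsHypothesis.Theorems.LacunarySymmetroidMatrixDescartes.Census
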